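import Literature.Geometry.Kaehler.FixedLocusLocalSection
import Literature.Geometry.Kaehler.FixedLocusChartProjection
import Mathlib.Analysis.Calculus.Implicit
import Mathlib.Analysis.Normed.Module.RCLike.Real
import HarnessLib

/-!
# A fixed point of a finite group acting fibrewise on a holomorphic family is ISOLATED among the
# fixed points of its fibre iff it is TRANSVERSAL (no non-zero invariant vertical tangent vector);
# at a non-transversal fixed point the fixed points accumulate in every nearby fibre (PROVED —
# implicit function theorem on Cartan's chart restricted to the fixed subspace)

Layer `Literature/Geometry/Kaehler`; continues `FiniteGroupHolomorphicLinearization.lean` (Cartan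
1957: `exists_linearizing_chart_chartAt`), `FixedLocusChartProjection.lean`
(`exists_chart_proj_hasFDerivAt`) and `FixedLocusLocalSection.lean`
(`exists_local_section_of_fixedPoints`), which lists under «Not here» "the finite-fibre variant
(isolated fixed point in the fibre ⇒ transversal, one implicit-function step more)".  This file is
that implicit-function step; `FixedLocusFiniteFibre.lean` draws the global consequence (a finite
fixed set in ONE fibre of a proper family over a connected base ⇒ the same number of fixed points in
every fibre) — step (iii) of the print-synthesis record
`Literature.AlgebraicGeometry.Hyperkaehler.HassettTschinkel2013_Oguiso2020_fixedPointScheme_translation_kum4Type`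
AS WRITTEN there («where the fixed points are ISOLATED: `Fix(G) → B` has relative dimension `0`»).
Cross-ladder literature layer of ladder HodgeAV, rung H3 (cell `hodge-kum4`, sub-home `lit-family`,
tranche LT-H3 (b): «fixed locus of a finite group acting fibrewise on a smooth proper family is
smooth over the base», analytic category).

## Sources

* H. Cartan, *Quotient d'un espace analytique par un groupe d'automorphismes* (1957)
  [`Cartan1957QuotientAnalytique`], §4 (proof of Théorème 4): in linearising coordinates the fixed
  locus is the linear subspace of invariants — so it is a submanifold with tangent space `(T_a M)^G`;
  the printed sentence in the setting of this tranche: K. Oguiso, *No cohomologically trivial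
  nontrivial automorphism of generalized Kummer manifolds*, Nagoya Math. J. 239 (2020)
  [`Oguiso2020CohomologicallyTrivialKummer`], Prop. 3.5, proof [corpus: paper:arxiv-1208.3750
  p0005:L92–L96], VERBATIM: "Since `h` is of finite order, `h` is locally linearizable at `P` […]
  Then `F` is locally defined by `x_j = 0` […] Hence `F` is smooth […] the tangent space `T_PF` of
  `F` is exactly the invariant subspace `(T_PM)^{h_{*,P}}`."  Relative to the fibre through `a` this
  reads: `a` is isolated among the fixed points of its fibre iff `(T_a M_{π a})^G = 0`.
* B. Edixhoven, *Néron models and tame ramification*, Compositio Math. 81 (1992)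
  [`Edixhoven1992NeronModelsTame`], §3 Prop. 3.4 with proof (NUMDAM text p0005 L27 – p0006 L15):
  `X^G → S` is smooth, of relative dimension at `x` the rank `e` of the trivial part of the
  linearised representation ("`B/I … ≅ A[[T₁,…,T_e]]`"); the analytic counterpart proved here is
  that the level sets of `π` on `Fix(G)` near `a` are copies of open pieces of the kernel `K` of
  `dπ_a` on `(T_a M)^G` — positive-dimensional, hence without isolated points, iff `e = dim K > 0`.

## Statements (tree carriers, as in `FixedLocusLocalSection`) and proofs

`M`, `B` complex manifolds modelled on `E` (finite-dimensional), `EB`; `π : M → B` holomorphic;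
`G` finite, `ρ : G →* (M ≃ₜ M)` biholomorphic with `π ∘ ρ g = π`; `a` a fixed point with `dπ_a`
onto; differentials = Mathlib's `mfderiv`; «transversal» = `∀ w, (∀ g, dρ(g)_a w = w) → dπ_a w = 0
→ w = 0`; «accumulation point» = Mathlib's `AccPt a (𝓟 S)`, `S` = the fixed points of the fibre
`π⁻¹(π a)`.

* `exists_nhds_eq_of_transversal`, `not_accPt_fixedPoints_of_transversal` — transversal ⇒ an open
  `W ∋ a` in which two fixed points of the same fibre coincide (uniqueness clause of
  `exists_local_section_of_fixedPoints`); in particular `a` is not an accumulation point of `S`.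
* `exists_nhds_accPt_fixedPoints_of_not_transversal` — NOT transversal ⇒ an open `W' ∋ π a` and
  fixed points `c b ∈ π⁻¹(b)` (`b ∈ W'`, `c (π a) = a`) each an accumulation point of the fixed
  points of its own fibre.  PROOF: with Cartan's chart `σ` and `h = ψ ∘ π ∘ σ⁻¹`
  (`exists_chart_proj_hasFDerivAt`: `Dh(0) = dπ_a`, `Dh(0) ∘ L g = Dh(0)`), the restriction
  `k = h|_F` to the fixed subspace `F = E^{L(G)}` (`fixedSubmodule L`) has derivative `k'` ONTO `EB`
  (averaging `(1/|G|) Σ_g L g`) with kernel `K ∋ w ≠ 0`; Mathlib's implicit function theorem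
  `HasStrictFDerivAt.implicitToOpenPartialHomeomorph` gives a local homeomorphism `Φ : F → EB × K`
  at `0` with first component `k`; restricted to the part of `F` over the domain of `h`, the points
  `Φ⁻¹(ψ b, κ)` are coordinate vectors of fixed points of `π⁻¹(b)` (`fixedBy_iff_of_linearization`),
  `κ ↦ σ⁻¹ Φ⁻¹(ψ b, κ)` is continuous and injective near `κ = 0`, and a punctured neighbourhood of
  `0` in `K ≠ 0` is non-empty — so `c b = σ⁻¹ Φ⁻¹(ψ b, 0)` is an accumulation point.
* `accPt_fixedPoints_of_not_transversal`, `accPt_fixedPoints_iff_not_transversal` — the pointwise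
  case and the equivalence «accumulation point ⟺ not transversal».

Everything proved; no definitions, no instances, no notation, NO named fact.

## Not here

The global count (`FixedLocusFiniteFibre.lean`); a manifold structure on `Fix(G)` or the constancy
of `dim (T_x M_{π x})^G` along `Fix(G)` (positive relative dimension); holomorphy of the implicit
function (only continuity is used).
-/

noncomputable section

open scoped Manifold ContDiff Topology
open Function Set Filter

universe u v u' v' w

namespace Literature.Geometry.Kaehler

section IsolatedTransversal

variable {E : Type u} [NormedAddCommGroup E] [NormedSpace ℂ E] [FiniteDimensional ℂ E]
  {M : Type v} [TopologicalSpace M] [ChartedSpace E M] [IsManifold 𝓘(ℂ, E) ω M]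
  {EB : Type u'} [NormedAddCommGroup EB] [NormedSpace ℂ EB]
  {B : Type v'} [TopologicalSpace B] [ChartedSpace EB B] [IsManifold 𝓘(ℂ, EB) ω B]
  {G : Type w} [Group G] [Finite G]

/-- **A transversal fixed point is isolated in its fibre, uniformly**: at a fixed point `a` with
`dπ_a` onto and no non-zero `G`-fixed vertical tangent vector, there is an open `W ∋ a` in which two
fixed points lying in the same fibre of `π` coincide (the uniqueness clause of
`exists_local_section_of_fixedPoints`: `Fix(G) ∩ W` is the image of a section).
[cite: Edixhoven1992NeronModelsTame, §3 Prop. 3.4 (analytic analogue, relative dimension 0)]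
[cite: Cartan1957QuotientAnalytique, §4 (proof of Théorème 4)] -/
theorem exists_nhds_eq_of_transversal (ρ : G →* (M ≃ₜ M))
    (hρ : ∀ g : G, ContMDiff 𝓘(ℂ, E) 𝓘(ℂ, E) ω (ρ g : M → M))
    {π : M → B} (hπ : ContMDiff 𝓘(ℂ, E) 𝓘(ℂ, EB) ω π) (hπρ : ∀ (g : G) (x : M), π (ρ g x) = π x)
    {a : M} (ha : ∀ g : G, ρ g a = a)
    (hsurj : Surjective (mfderiv 𝓘(ℂ, E) 𝓘(ℂ, EB) π a))
    (htrans : ∀ w : TangentSpace 𝓘(ℂ, E) a,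
      (∀ g : G, mfderiv 𝓘(ℂ, E) 𝓘(ℂ, E) (ρ g : M → M) a w = w) →
        mfderiv 𝓘(ℂ, E) 𝓘(ℂ, EB) π a w = 0 → w = 0) :
    ∃ W : Set M, IsOpen W ∧ a ∈ W ∧
      ∀ x ∈ W, ∀ y ∈ W, (∀ g : G, ρ g x = x) → (∀ g : G, ρ g y = y) → π y = π x → y = x := by
  obtain ⟨W, W', s, hWo, haW, -, -, -, -, huniq⟩ :=
    exists_local_section_of_fixedPoints ρ hρ hπ hπρ ha hsurj htrans
  refine ⟨W, hWo, haW, fun x hx y hy hfx hfy hπ' => ?_⟩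
  rw [← (huniq x hx hfx).2, ← (huniq y hy hfy).2, hπ']

/-- **A transversal fixed point is not an accumulation point of the fixed points of its fibre**
(Cartan: `Fix(G)` is a submanifold with tangent space the invariants; Edixhoven: relative
dimension `e = 0`). [cite: Cartan1957QuotientAnalytique, §4 (proof of Théorème 4)]
[cite: Edixhoven1992NeronModelsTame, §3 Prop. 3.4 (analytic analogue, relative dimension 0)] -/
theorem not_accPt_fixedPoints_of_transversal (ρ : G →* (M ≃ₜ M))
    (hρ : ∀ g : G, ContMDiff 𝓘(ℂ, E) 𝓘(ℂ, E) ω (ρ g : M → M))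
    {π : M → B} (hπ : ContMDiff 𝓘(ℂ, E) 𝓘(ℂ, EB) ω π) (hπρ : ∀ (g : G) (x : M), π (ρ g x) = π x)
    {a : M} (ha : ∀ g : G, ρ g a = a)
    (hsurj : Surjective (mfderiv 𝓘(ℂ, E) 𝓘(ℂ, EB) π a))
    (htrans : ∀ w : TangentSpace 𝓘(ℂ, E) a,
      (∀ g : G, mfderiv 𝓘(ℂ, E) 𝓘(ℂ, E) (ρ g : M → M) a w = w) →
        mfderiv 𝓘(ℂ, E) 𝓘(ℂ, EB) π a w = 0 → w = 0) :
    ¬ AccPt a (𝓟 {y : M | (∀ g : G, ρ g y = y) ∧ π y = π a}) := by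
  obtain ⟨W, hWo, haW, hW⟩ := exists_nhds_eq_of_transversal ρ hρ hπ hπρ ha hsurj htrans
  rw [accPt_iff_nhds]
  intro h
  obtain ⟨y, ⟨hyW, hyfix, hπy⟩, hne⟩ := h W (hWo.mem_nhds haW)
  exact hne (hW a haW y hyW ha hyfix hπy)

/-- **At a non-transversal fixed point the fixed points accumulate, in every nearby fibre**
(implicit function theorem on Cartan's chart restricted to the fixed subspace; Edixhoven's relative
dimension `e > 0`): if `a` is a fixed point with `dπ_a` onto and SOME non-zero `G`-fixed vertical
tangent vector, there are an open `W' ∋ π a` and points `c b` (`b ∈ W'`), `c (π a) = a`, such that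
`c b` is a fixed point of the fibre `π⁻¹(b)` which is an ACCUMULATION POINT of the fixed points of
that fibre.  PROOF: `h = ψ ∘ π ∘ σ⁻¹` restricted to `F = E^{L(G)}` has onto derivative at `0`
(averaging) with non-zero kernel `K`; `HasStrictFDerivAt.implicitToOpenPartialHomeomorph` makes the
level sets of `h|_F` near `0` copies of open pieces of `K`, and `σ⁻¹` maps the level set at `ψ b`
into the fixed points of `π⁻¹(b)`. [cite: Cartan1957QuotientAnalytique, §4 (proof of Théorème 4)]
[cite: Edixhoven1992NeronModelsTame, §3 Prop. 3.4 (analytic analogue, relative dimension e)] -/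
theorem exists_nhds_accPt_fixedPoints_of_not_transversal (ρ : G →* (M ≃ₜ M))
    (hρ : ∀ g : G, ContMDiff 𝓘(ℂ, E) 𝓘(ℂ, E) ω (ρ g : M → M))
    {π : M → B} (hπ : ContMDiff 𝓘(ℂ, E) 𝓘(ℂ, EB) ω π) (hπρ : ∀ (g : G) (x : M), π (ρ g x) = π x)
    {a : M} (ha : ∀ g : G, ρ g a = a)
    (hsurj : Surjective (mfderiv 𝓘(ℂ, E) 𝓘(ℂ, EB) π a))
    (hnt : ∃ w : TangentSpace 𝓘(ℂ, E) a,
      (∀ g : G, mfderiv 𝓘(ℂ, E) 𝓘(ℂ, E) (ρ g : M → M) a w = w) ∧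
        mfderiv 𝓘(ℂ, E) 𝓘(ℂ, EB) π a w = 0 ∧ w ≠ 0) :
    ∃ (W' : Set B) (c : B → M), IsOpen W' ∧ π a ∈ W' ∧ c (π a) = a ∧
      ∀ b ∈ W', (∀ g : G, ρ g (c b) = c b) ∧ π (c b) = b ∧
        AccPt (c b) (𝓟 {y : M | (∀ g : G, ρ g y = y) ∧ π y = b}) := by
  classical
  haveI : Fintype G := Fintype.ofFinite G
  have hω : (ω : WithTop ℕ∞) ≠ 0 := by simp
  -- Cartan's chart and the family read in it
  obtain ⟨σ, hσmax, haσ, hσa, hσstab, L, hσlin, hLmf, hσtan⟩ :=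
    exists_linearizing_chart_chartAt ρ hρ ha
  obtain ⟨V, hVopen, h0V, hVtarget, hVsrc, hhV, hhT, hTL, hTP⟩ :=
    exists_chart_proj_hasFDerivAt ρ hπ hπρ hσmax haσ hσa hσstab hσlin hσtan
  set ψ : OpenPartialHomeomorph B EB := chartAt EB (π a) with hψdef
  set h : E → EB := fun v => ψ (π (σ.symm v)) with hhdef
  set T : E →L[ℂ] EB := fderiv ℂ h 0 with hTdef
  have haψ : π a ∈ ψ.source := mem_chart_source EB (π a)
  have hh0 : ContDiffAt ℂ ω h 0 := hhV.contDiffAt (hVopen.mem_nhds h0V)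
  -- the fixed subspace and `k = h|_F`
  set F : Submodule ℂ E := fixedSubmodule L with hFdef
  haveI : CompleteSpace F := FiniteDimensional.complete ℂ F
  set k : F → EB := fun u => h (u : E) with hkdef
  set k' : F →L[ℂ] EB := T.comp F.subtypeL with hk'def
  have hk : ContDiffAt ℂ ω k 0 := by
    have : ContDiffAt ℂ ω h ((F.subtypeL) 0) := by rw [map_zero]; exact hh0
    exact this.comp 0 F.subtypeL.contDiff.contDiffAt
  have hkd : HasFDerivAt k k' 0 := by
    have : HasFDerivAt h T ((F.subtypeL) 0) := by rw [map_zero]; exact hhT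
    exact this.comp 0 F.subtypeL.hasFDerivAt
  have hks : HasStrictFDerivAt k k' 0 := hk.hasStrictFDerivAt' hkd hω
  -- `k'` is onto (averaging)
  have hk'surj : Surjective k' := by
    intro w
    obtain ⟨v₀, hv₀⟩ := hsurj w
    set r : ℂ := (Fintype.card G : ℂ) with hrdef
    have hr : r ≠ 0 := Nat.cast_ne_zero.2 Fintype.card_ne_zero
    refine ⟨⟨r⁻¹ • ∑ g : G, L g v₀, fun g' => ?_⟩, ?_⟩
    · rw [map_smul, map_sum]
      congr 1
      have : ∀ g : G, L g' (L g v₀) = L (g' * g) v₀ := fun g => by rw [map_mul]; rfl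
      simp_rw [this]
      exact Fintype.sum_equiv (Equiv.mulLeft g') _ _ fun g => rfl
    · show T (r⁻¹ • ∑ g : G, L g v₀) = w
      rw [map_smul, map_sum]
      have : ∀ g : G, T (L g v₀) = w := fun g => by
        rw [← ContinuousLinearMap.comp_apply, hTL g, hTP, hv₀]
      simp_rw [this]
      rw [Finset.sum_const, Finset.card_univ, ← Nat.cast_smul_eq_nsmul ℂ, smul_smul,
        inv_mul_cancel₀ hr, one_smul]
  have hk'range : k'.range = ⊤ := LinearMap.range_eq_top.2 hk'surj
  haveI : FiniteDimensional ℂ EB := Module.Finite.of_surjective (k' : F →ₗ[ℂ] EB) hk'surj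
  -- the kernel `K` of `k'` is non-zero (`a` is not transversal)
  obtain ⟨w, hwfix, hwT, hw0⟩ := hnt
  have hwF : (w : E) ∈ F := fun g => by rw [hLmf g]; exact hwfix g
  set K : Submodule ℂ F := k'.ker with hKdef
  have hwK : (⟨w, hwF⟩ : F) ∈ K := by
    rw [hKdef, LinearMap.mem_ker]
    show T w = 0
    rw [hTP]; exact hwT
  have hκ₀ : (⟨⟨w, hwF⟩, hwK⟩ : K) ≠ 0 := by
    intro h0
    apply hw0
    have h1 := congrArg (fun z : K => ((z : F) : E)) h0
    simp only [Submodule.coe_zero] at h1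
    exact h1
  haveI : Nontrivial K := ⟨⟨_, 0, hκ₀⟩⟩
  -- implicit function theorem for `k` at `0`, restricted to the part of `F` over `V`
  set Φ : OpenPartialHomeomorph F (EB × K) := hks.implicitToOpenPartialHomeomorph k k' hk'range
    with hΦdef
  have hΦfst : ∀ u : F, (Φ u).1 = k u := fun u =>
    hks.implicitToOpenPartialHomeomorph_fst hk'range u
  have h0Φ : (0 : F) ∈ Φ.source := hks.mem_implicitToOpenPartialHomeomorph_source hk'range
  have hΦ0 : Φ 0 = (k 0, 0) := hks.implicitToOpenPartialHomeomorph_self hk'range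
  set O : Set F := Subtype.val ⁻¹' V with hOdef
  have hOopen : IsOpen O := hVopen.preimage continuous_subtype_val
  set Φ₁ : OpenPartialHomeomorph F (EB × K) := Φ.restrOpen O hOopen with hΦ₁def
  have hΦ₁coe : (Φ₁ : F → EB × K) = Φ := rfl
  have hΦ₁source : Φ₁.source = Φ.source ∩ O := Φ.restrOpen_source O hOopen
  have h0Φ₁ : (0 : F) ∈ Φ₁.source := by
    rw [hΦ₁source]; exact ⟨h0Φ, show ((0 : F) : E) ∈ V from h0V⟩
  have hk0 : k 0 = ψ (π a) := by
    show ψ (π (σ.symm ((0 : F) : E))) = ψ (π a)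
    rw [Submodule.coe_zero, ← hσa, σ.left_inv haσ]
  -- every point `Φ₁⁻¹ (e, κ)` is (the coordinate vector of) a fixed point over `ψ⁻¹ e`
  have hpt : ∀ p ∈ Φ₁.target, ((Φ₁.symm p : F) : E) ∈ V ∧
      (∀ g : G, ρ g (σ.symm ((Φ₁.symm p : F) : E)) = σ.symm ((Φ₁.symm p : F) : E)) ∧
      ψ (π (σ.symm ((Φ₁.symm p : F) : E))) = p.1 ∧
      π (σ.symm ((Φ₁.symm p : F) : E)) ∈ ψ.source := by
    intro p hp
    set u : F := Φ₁.symm p with hudef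
    have hu : u ∈ Φ₁.source := Φ₁.map_target hp
    have huV : (u : E) ∈ V := by rw [hΦ₁source] at hu; exact hu.2
    have hux : σ.symm (u : E) ∈ σ.source := σ.map_target (hVtarget huV)
    have hσu : σ (σ.symm (u : E)) = u := σ.right_inv (hVtarget huV)
    refine ⟨huV, ?_, ?_, (hVsrc _ huV).2⟩
    · exact (fixedBy_iff_of_linearization hσstab hσlin hux).2 fun g => by rw [hσu]; exact u.2 g
    · show k u = p.1
      rw [← hΦfst, ← hΦ₁coe, hudef, Φ₁.right_inv hp]
  -- `N = {e | (e, 0) ∈ Φ₁.target}` and `W' = ψ⁻¹ N`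
  set N : Set EB := {e | (e, (0 : K)) ∈ Φ₁.target} with hNdef
  have hNopen : IsOpen N := Φ₁.open_target.preimage (continuous_id.prodMk continuous_const)
  have hk0N : k 0 ∈ N := by
    show (k 0, (0 : K)) ∈ Φ₁.target
    rw [← hΦ0, ← hΦ₁coe]; exact Φ₁.map_source h0Φ₁
  set W' : Set B := ψ.source ∩ ψ ⁻¹' N with hW'def
  have hW'open : IsOpen W' := ψ.continuousOn.isOpen_inter_preimage ψ.open_source hNopen
  set c : B → M := fun b => σ.symm ((Φ₁.symm (ψ b, 0) : F) : E) with hcdef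
  refine ⟨W', c, hW'open, ⟨haψ, ?_⟩, ?_, fun b hb => ?_⟩
  · show ψ (π a) ∈ N
    rw [← hk0]; exact hk0N
  · -- `c (π a) = a`
    show σ.symm ((Φ₁.symm (ψ (π a), 0) : F) : E) = a
    rw [← hk0, ← hΦ0, ← hΦ₁coe, Φ₁.left_inv h0Φ₁, Submodule.coe_zero, ← hσa, σ.left_inv haσ]
  · have hb0 : (ψ b, (0 : K)) ∈ Φ₁.target := hb.2
    obtain ⟨hu0V, hx0fix, hx0ψ, hx0π⟩ := hpt _ hb0
    have hπc : π (c b) = b := ψ.injOn hx0π hb.1 hx0ψ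
    refine ⟨hx0fix, hπc, ?_⟩
    rw [accPt_iff_nhds]
    intro U hU
    -- the curve `κ ↦ σ⁻¹ (Φ₁⁻¹ (ψ b, κ))` of fixed points over `b` is continuous at `κ = 0`
    set γ : K → M := fun κ => σ.symm ((Φ₁.symm (ψ b, κ) : F) : E) with hγdef
    have hγ : ContinuousAt γ 0 := by
      have h1 : Continuous fun κ : K => ((ψ b, κ) : EB × K) := continuous_const.prodMk continuous_id
      have h2 : ContinuousAt Φ₁.symm (ψ b, (0 : K)) := Φ₁.continuousAt_symm hb0
      have h3 : ContinuousAt (fun κ : K => Φ₁.symm (ψ b, κ)) 0 :=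
        ContinuousAt.comp (f := fun κ : K => ((ψ b, κ) : EB × K)) h2 h1.continuousAt
      have h4 : ContinuousAt (fun κ : K => ((Φ₁.symm (ψ b, κ) : F) : E)) 0 :=
        continuous_subtype_val.continuousAt.comp h3
      have h5 : ContinuousAt σ.symm ((Φ₁.symm (ψ b, (0 : K)) : F) : E) :=
        σ.continuousAt_symm (hVtarget hu0V)
      exact ContinuousAt.comp (f := fun κ : K => ((Φ₁.symm (ψ b, κ) : F) : E)) h5 h4
    have hS1 : γ ⁻¹' U ∈ 𝓝 (0 : K) := hγ.preimage_mem_nhds hU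
    have hS2 : (fun κ : K => ((ψ b, κ) : EB × K)) ⁻¹' Φ₁.target ∈ 𝓝 (0 : K) :=
      (continuous_const.prodMk continuous_id).continuousAt.preimage_mem_nhds
        (Φ₁.open_target.mem_nhds hb0)
    obtain ⟨κ, hκ0, hκU, hκt⟩ : ({(0 : K)}ᶜ ∩ (γ ⁻¹' U ∩
        (fun κ : K => ((ψ b, κ) : EB × K)) ⁻¹' Φ₁.target)).Nonempty :=
      (inferInstance : NeBot (𝓝[≠] (0 : K))).nonempty_of_mem
        (inter_mem_nhdsWithin _ (inter_mem hS1 hS2))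
    have hbκ : (ψ b, κ) ∈ Φ₁.target := hκt
    obtain ⟨huκV, hyfix, hyψ, hyπ⟩ := hpt _ hbκ
    refine ⟨γ κ, ⟨hκU, hyfix, ψ.injOn hyπ hb.1 hyψ⟩, fun heq => hκ0 ?_⟩
    -- `γ κ = c b` forces `κ = 0`
    have h1 : ((Φ₁.symm (ψ b, κ) : F) : E) = ((Φ₁.symm (ψ b, 0) : F) : E) :=
      σ.symm.injOn (hVtarget huκV) (hVtarget hu0V) heq
    have h2 : Φ₁.symm (ψ b, κ) = Φ₁.symm (ψ b, 0) := Subtype.ext h1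
    have h3 : ((ψ b, κ) : EB × K) = (ψ b, 0) := Φ₁.symm.injOn hbκ hb0 h2
    exact (Prod.ext_iff.1 h3).2

/-- **At a non-transversal fixed point the fixed points of the fibre accumulate** (the pointwise
case `b = π a` of `exists_nhds_accPt_fixedPoints_of_not_transversal`).
[cite: Cartan1957QuotientAnalytique, §4 (proof of Théorème 4)]
[cite: Edixhoven1992NeronModelsTame, §3 Prop. 3.4 (analytic analogue, relative dimension e)] -/
theorem accPt_fixedPoints_of_not_transversal (ρ : G →* (M ≃ₜ M))
    (hρ : ∀ g : G, ContMDiff 𝓘(ℂ, E) 𝓘(ℂ, E) ω (ρ g : M → M))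
    {π : M → B} (hπ : ContMDiff 𝓘(ℂ, E) 𝓘(ℂ, EB) ω π) (hπρ : ∀ (g : G) (x : M), π (ρ g x) = π x)
    {a : M} (ha : ∀ g : G, ρ g a = a)
    (hsurj : Surjective (mfderiv 𝓘(ℂ, E) 𝓘(ℂ, EB) π a))
    (hnt : ∃ w : TangentSpace 𝓘(ℂ, E) a,
      (∀ g : G, mfderiv 𝓘(ℂ, E) 𝓘(ℂ, E) (ρ g : M → M) a w = w) ∧
        mfderiv 𝓘(ℂ, E) 𝓘(ℂ, EB) π a w = 0 ∧ w ≠ 0) :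
    AccPt a (𝓟 {y : M | (∀ g : G, ρ g y = y) ∧ π y = π a}) := by
  obtain ⟨W', c, -, haW', hca, hc⟩ :=
    exists_nhds_accPt_fixedPoints_of_not_transversal ρ hρ hπ hπρ ha hsurj hnt
  have h := (hc (π a) haW').2.2
  rwa [hca] at h

/-- **Isolated ⟺ transversal** (Cartan 1957 §4 / Oguiso 2020 Prop. 3.5 «the tangent space of the
fixed locus is exactly the invariant subspace», relative to the fibre; Edixhoven 1992 Prop. 3.4:
the relative dimension of the fixed locus at `a` is the rank `e` of the trivial part of the vertical
tangent representation): a fixed point `a` with `dπ_a` onto is an accumulation point of the fixed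
points of its fibre iff some non-zero `G`-fixed tangent vector at `a` is vertical.
[cite: Cartan1957QuotientAnalytique, §4 (proof of Théorème 4)]
[cite: Edixhoven1992NeronModelsTame, §3 Prop. 3.4 (analytic analogue)] -/
theorem accPt_fixedPoints_iff_not_transversal (ρ : G →* (M ≃ₜ M))
    (hρ : ∀ g : G, ContMDiff 𝓘(ℂ, E) 𝓘(ℂ, E) ω (ρ g : M → M))
    {π : M → B} (hπ : ContMDiff 𝓘(ℂ, E) 𝓘(ℂ, EB) ω π) (hπρ : ∀ (g : G) (x : M), π (ρ g x) = π x)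
    {a : M} (ha : ∀ g : G, ρ g a = a)
    (hsurj : Surjective (mfderiv 𝓘(ℂ, E) 𝓘(ℂ, EB) π a)) :
    AccPt a (𝓟 {y : M | (∀ g : G, ρ g y = y) ∧ π y = π a}) ↔
      ∃ w : TangentSpace 𝓘(ℂ, E) a,
        (∀ g : G, mfderiv 𝓘(ℂ, E) 𝓘(ℂ, E) (ρ g : M → M) a w = w) ∧
          mfderiv 𝓘(ℂ, E) 𝓘(ℂ, EB) π a w = 0 ∧ w ≠ 0 := by
  refine ⟨fun h => ?_, accPt_fixedPoints_of_not_transversal ρ hρ hπ hπρ ha hsurj⟩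
  by_contra hne
  push Not at hne
  exact not_accPt_fixedPoints_of_transversal ρ hρ hπ hπρ ha hsurj hne h

end IsolatedTransversal

end Literature.Geometry.Kaehler

end
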